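import Summits.Ventures.CertifiedManyBodySolver.Observables.XYCertificateCeiling
import Literature.Probability.LatticeModels.LayeredPlaneRotatorUniformDecay
import Literature.Probability.LatticeModels.LayeredPlaneRotatorStackSusceptibilityBound
import HarnessLib

/-!
# Ventures/CertifiedManyBodySolver — Observables/XYSusceptibilityTransitionCeiling.lean

HONEST FRAMING: a number-neutral SOCKET for the cell `pub/hubbard-tc`'s MODELLING KEY K5 (the XY / phase-ordering dictionary
`XYDictionaryAt` of `XYCertificateCeiling.lean`: «`T_c` of the layered material does not exceed the ordering temperature of the
classical layered XY model with couplings `J∥ = ρₑ(0)/2`, `J⊥ = Δ·J∥`»). CONDITIONAL on that structure (K5 + the identification K1b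
are HYPOTHESES, never certified) and on a ceiling `ρₑ₀ ≤ C` fed in. Not a `T_c` estimate, not a superconductivity verdict (a
ceiling never speaks to presence); no value of the comparison stack's transition coupling is computed here. Cell `hubbard-tc`
(MO-S3 ORDER → `T_c` back-end, D-0096), seat p2 (prover «2D→3D ordering lemmas; composition on obs row types»),
`prover-hubbard-tc-p2-g23-0`; lead RULING R113 (q7). ASSUMPTIONS.md §1 keys K5, K1b, I2, I1, K4.

**The observation.** The dictionary's trigger `LayeredXYDecayAt β J∥ J⊥` («the comparison stack decays across the layers
geometrically, uniformly in the volume, WITHOUT prefactor») holds at EVERY point of the stack's finite-susceptibility phase: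
`∑_z G^{3D,free,∞}_{β;J∥,J⊥}(0,z) < ∞ ⇒ LayeredXYDecayAt β J∥ J⊥` — Simon–Lieb cube decay of the infinite-volume function,
Griffiths–Ginibre domination of every finite volume, and the one-site heat-bath bound `⟨cos(θ_a − θ_c)⟩_Λ ≤ 1 − e^{−2β(4J∥+2J⊥)}`
(`a ≠ c`) that removes the block prefactor (Literature `LayeredPlaneRotatorUniformDecay.lean`,
`PlaneRotator.exists_uniform_layer_decay_of_summable`). Hence, with the tree's susceptibility-transition coupling of the stack
`K_χ^{3D}(Δ) := sup{K ≥ 0 : ∑_z G^{3D}_{(K, ΔK)}(0,z) < ∞}` (`PlaneRotator.layeredSusceptibilityCriticalCoupling`,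
`PlaneRotatorTransitionCouplings.lean` §4) and `T_χ^{3D}(J∥, ΔJ∥) = J∥ / K_χ^{3D}(Δ)`:

PROVED (namespace `XYDictionaryAt`, for every `(tp, U, n, Δ, ρₑ₀, Tc)` satisfying the dictionary and every ceiling `ρₑ₀ ≤ C`):
* §1 `le_inv_of_summable` — `β > 0`, `∑_z G^{3D,free,∞}_{β; C/2, Δ·C/2}(0,z) < ∞ ⇒ Tc ≤ 1/β`;
  `le_inv_of_mul_lt_layeredSusceptibilityCriticalCoupling` — `ofReal(β·C/2) < K_χ^{3D}(Δ) ⇒ Tc ≤ 1/β`;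
  `le_of_lt_layeredSusceptibilityCriticalCoupling` — `T > 0`, `ofReal((C/2)/T) < K_χ^{3D}(Δ) ⇒ Tc ≤ T`.
* §2 **the socket** `le_div_of_ofReal_le_layeredSusceptibilityCriticalCoupling` — `0 < K₀`, `ofReal K₀ ≤ K_χ^{3D}(Δ) ⇒
  Tc ≤ (C/2)/K₀`: EVERY lower bound on the stack's transition coupling (box `2/π`, Fisher windows, the RPA interlayer criterion,
  the log² law, …) is a row-level ceiling through this one theorem;
  `le_div_toReal_layeredSusceptibilityCriticalCoupling` — `K_χ^{3D}(Δ) ≠ 0 ⇒ Tc ≤ (C/2)/K_χ^{3D}(Δ).toReal`;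
  **the headline `ofReal_le_layeredSusceptibilityTemperature`** — `ofReal Tc ≤ ofReal(C/2) ∕ K_χ^{3D}(Δ) = T_χ^{3D}(C/2, Δ·C/2)`,
  hypothesis-free beyond the dictionary and the ceiling: **under K5 the susceptibility-transition temperature of the comparison
  stack at the ceiling couplings is ITSELF the row-level ceiling** (I1's enhancement factor reads `E(Δ) = K_χ(2)/K_χ^{3D}(Δ) ≥ 1`,
  `PlaneRotator.layeredSusceptibilityCriticalCoupling_le`).
* §3 the two earlier windows as one-line instances of §2: `le_pi_div_four_mul_of_anis_le_via_socket` (`Δ ≤ 1/8 ⇒ Tc ≤ (π/4)·C`,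
  the statement of `XYFisherWindowCeiling.lean` §2 `le_pi_div_four_mul_of_anis_le`, now via p596136
  `ofReal_two_div_pi_le_layeredSusceptibilityCriticalCoupling`) and `le_div_of_forall_interlayer` (the RPA interlayer window in
  coupling currency: `Δ·K·χ₂(K) < 1` on `[0, c)` ⇒ `Tc ≤ (C/2)/c`, via `ofReal_le_layeredSusceptibilityCriticalCoupling_of_forall_interlayer`;
  the temperature form is `XYInterlayerCriterionCeiling.lean` §1 `le_of_interlayer_temperature`, landed, not restated — gate dedup).

NOT CLAIMED (RULING R113, verbatim list): no value of `K_χ^{3D}(Δ)` (none is computed or bounded here); K5 itself is assumed (a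
field of the hypothesis structure), never certified; the stiffness-currency twin is NOT obtained (`K_χ^{3D} ≤ K_Υ^{3D}` is the wrong
direction for a ceiling); no lower bound on `T_c` or on any correlation; BESIDE-CLASS (Q4) — no number ∕ kelvin ∕ count ∕ token
of record moves. No kit, no decimal, no instance, no notation, no `def`.

Presearch (D-0021): `χ < ∞ ⇒ m > 0` is Simon 1980 Thm 1.3 ∕ Lieb 1980 Thm 4 (the tree's citations); «T_c of a layered
superconductor ≤ the susceptibility-transition temperature of the phase-only stack» as a THEOREM under a stated dictionary: none in
print (corpus hybrid 8, vsearch 8, galaxy all 8 rows — generic); the phase-ordering READING is Hazra–Verma–Randeria 2019 §«Three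
dimensional systems» with their own caveat.

References: B. Simon, CMP 77 (1980) 111, Thm 1.3 [Simon1980CMP]; E. H. Lieb, CMP 77 (1980) 127 [Lieb1980]; L. L. Liu,
H. E. Stanley, PRL 29 (1972) 927 [LiuStanley1972]; T. Hazra, N. Verma, M. Randeria, PRX 9 (2019) 031049 [HazraVermaRanderia2019];
D. J. Scalapino, S. R. White, S.-C. Zhang, PRB 47 (1993) 7995, §II [ScalapinoWhiteZhang1993].
-/

noncomputable section

namespace Summit.Ventures.CertifiedManyBodySolver.Observables

open Real Literature.Probability.LatticeModels Literature.Probability.LatticeModels.PlaneRotator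
open Literature.Barriers.CriticalPhenomena.LongRangeIsing
open scoped ENNReal

variable [MeasurableSpace Circle] [BorelSpace Circle]

namespace XYDictionaryAt

variable {tp U n Δ ρe0 Tc : ℝ}

/-! ## §1 Finite stack susceptibility at the ceiling couplings ⇒ `Tc ≤ 1/β` -/

/-- **K5 composition through a finite stack susceptibility.** Under the XY dictionary at `(U, n, t′, Δ)`: a ceiling `ρₑ₀ ≤ C` and an
inverse temperature `β > 0` at which the comparison stack with the LARGER couplings `(C/2, Δ·C/2)` has a summable infinite-volume free
two-point function give `Tc ≤ 1/β` — the stack decays across the layers geometrically without prefactor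
(`PlaneRotator.exists_uniform_layer_decay_of_summable`), hence so does the one with couplings `(ρₑ₀/2, Δ·ρₑ₀/2)` (Ginibre,
`LayeredXYDecayAt.mono`), and the K5 field concludes. [cite: Simon1980CMP, Thm 1.3] [cite: HazraVermaRanderia2019, §«Three dimensional systems»] -/
theorem le_inv_of_summable (h : XYDictionaryAt tp U n Δ ρe0 Tc) {C : ℝ} (hC : ρe0 ≤ C) {β : ℝ} (hβ : 0 < β)
    (hsum : Summable fun z : Site 3 => infTwoPointLayered β (C / 2) (Δ * (C / 2)) 0 z) : Tc ≤ 1 / β := by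
  have hCpos : 0 < C := h.ground_pos.trans_le hC
  obtain ⟨r, -, hr1, hdec⟩ := exists_uniform_layer_decay_of_summable hβ.le (half_pos hCpos).le
    (mul_nonneg h.anis_nonneg (half_pos hCpos).le) hsum
  have hdecC : LayeredXYDecayAt β (C / 2) (Δ * (C / 2)) := ⟨r, hr1, hdec⟩
  exact h.xy β hβ (hdecC.mono hβ.le (half_pos h.ground_pos).le (by linarith)
    (mul_nonneg h.anis_nonneg (half_pos h.ground_pos).le) (mul_le_mul_of_nonneg_left (by linarith) h.anis_nonneg))

/-- **Reduced-coupling form**: under the dictionary with a ceiling `ρₑ₀ ≤ C`, every `β > 0` with `ofReal(β·C/2) < K_χ^{3D}(Δ)` (the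
in-plane reduced coupling of the ceiling stack lies in the finite-susceptibility phase, `PlaneRotator.summable_layered_of_ofReal_lt`)
gives `Tc ≤ 1/β`. [cite: LiuStanley1972, p. 272 (T_c(ε) of the layers (J, J, εJ))] [cite: HazraVermaRanderia2019, §«Three dimensional systems»] -/
theorem le_inv_of_mul_lt_layeredSusceptibilityCriticalCoupling (h : XYDictionaryAt tp U n Δ ρe0 Tc) {C : ℝ} (hC : ρe0 ≤ C)
    {β : ℝ} (hβ : 0 < β) (hK : ENNReal.ofReal (β * (C / 2)) < layeredSusceptibilityCriticalCoupling Δ) : Tc ≤ 1 / β := by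
  have hCpos : 0 < C := h.ground_pos.trans_le hC
  have hsum := summable_layered_of_ofReal_lt h.anis_nonneg (mul_nonneg hβ.le (half_pos hCpos).le) hK
  exact h.le_inv_of_summable hC hβ (summable_layered_of_mul_le hβ.le (half_pos hCpos).le
    (mul_nonneg h.anis_nonneg (half_pos hCpos).le) le_rfl (le_of_eq (by ring)) hsum)

/-- **Temperature form**: under the dictionary with a ceiling `ρₑ₀ ≤ C` (`J∥ := C/2`, `J⊥ := Δ·J∥`), every temperature `T > 0` with
`ofReal(J∥/T) < K_χ^{3D}(Δ)` — i.e. every `T` above the susceptibility-transition temperature `T_χ^{3D}(J∥, J⊥)` of the comparison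
stack — is a ceiling: `Tc ≤ T`. [cite: LiuStanley1972, p. 272] [cite: HazraVermaRanderia2019, §«Three dimensional systems»] -/
theorem le_of_lt_layeredSusceptibilityCriticalCoupling (h : XYDictionaryAt tp U n Δ ρe0 Tc) {C : ℝ} (hC : ρe0 ≤ C) {T : ℝ}
    (hT : 0 < T) (hK : ENNReal.ofReal (C / 2 / T) < layeredSusceptibilityCriticalCoupling Δ) : Tc ≤ T := by
  have e : 1 / T * (C / 2) = C / 2 / T := by ring
  have key := h.le_inv_of_mul_lt_layeredSusceptibilityCriticalCoupling hC (one_div_pos.2 hT) (by rw [e]; exact hK)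
  rwa [one_div_one_div] at key

/-! ## §2 The socket and the headline: `T_χ^{3D}` of the ceiling stack is the row-level ceiling -/

/-- **THE SOCKET.** Under the dictionary with a ceiling `ρₑ₀ ≤ C`: every LOWER bound `ofReal K₀ ≤ K_χ^{3D}(Δ)` with `K₀ > 0` on the
stack's susceptibility-transition coupling is a row-level ceiling `Tc ≤ (C/2)/K₀` (every `T > (C/2)/K₀` has `(C/2)/T < K₀`, hence
lies strictly inside the finite-susceptibility phase; density of the reals). [cite: LiuStanley1972, p. 272] [cite: HazraVermaRanderia2019, §«Three dimensional systems»] -/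
theorem le_div_of_ofReal_le_layeredSusceptibilityCriticalCoupling (h : XYDictionaryAt tp U n Δ ρe0 Tc) {C : ℝ} (hC : ρe0 ≤ C)
    {K₀ : ℝ} (hK₀ : 0 < K₀) (hle : ENNReal.ofReal K₀ ≤ layeredSusceptibilityCriticalCoupling Δ) : Tc ≤ C / 2 / K₀ := by
  have hCpos : 0 < C := h.ground_pos.trans_le hC
  refine le_of_forall_gt_imp_ge_of_dense fun T hT => ?_
  have hT0 : 0 < C / 2 / K₀ := div_pos (half_pos hCpos) hK₀
  have hTpos : 0 < T := hT0.trans hT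
  refine h.le_of_lt_layeredSusceptibilityCriticalCoupling hC hTpos (lt_of_lt_of_le ?_ hle)
  rw [ENNReal.ofReal_lt_ofReal_iff hK₀, div_lt_iff₀ hTpos]
  rw [div_lt_iff₀ hK₀] at hT
  linarith

/-- **Real form of the headline**: if `K_χ^{3D}(Δ) ≠ 0` then `Tc ≤ (C/2)/K_χ^{3D}(Δ).toReal` (`= T_χ^{3D}(C/2, Δ·C/2)` when the coupling is
finite; if it were infinite every temperature would be a ceiling, contradicting `Tc > 0`). [cite: LiuStanley1972, p. 272] [cite: HazraVermaRanderia2019, §«Three dimensional systems»] -/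
theorem le_div_toReal_layeredSusceptibilityCriticalCoupling (h : XYDictionaryAt tp U n Δ ρe0 Tc) {C : ℝ} (hC : ρe0 ≤ C)
    (h0 : layeredSusceptibilityCriticalCoupling Δ ≠ 0) :
    Tc ≤ C / 2 / (layeredSusceptibilityCriticalCoupling Δ).toReal := by
  have hCpos : 0 < C := h.ground_pos.trans_le hC
  rcases eq_or_ne (layeredSusceptibilityCriticalCoupling Δ) ⊤ with htop | htop
  · -- every `β > 0` qualifies: contradiction with `0 < Tc`
    exfalso
    have hβ : 0 < 2 / Tc := div_pos two_pos h.pos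
    have key := h.le_inv_of_mul_lt_layeredSusceptibilityCriticalCoupling hC hβ (by rw [htop]; exact ENNReal.ofReal_lt_top)
    rw [one_div_div] at key
    linarith [h.pos]
  · have hKpos : 0 < (layeredSusceptibilityCriticalCoupling Δ).toReal := ENNReal.toReal_pos h0 htop
    have hle : ENNReal.ofReal (layeredSusceptibilityCriticalCoupling Δ).toReal ≤ layeredSusceptibilityCriticalCoupling Δ :=
      ENNReal.ofReal_toReal_le
    exact h.le_div_of_ofReal_le_layeredSusceptibilityCriticalCoupling hC hKpos hle

/-- **THE HEADLINE: under K5, `ofReal Tc ≤ ofReal(C/2) ∕ K_χ^{3D}(Δ) = T_χ^{3D}(C/2, Δ·C/2)`** — the susceptibility-transition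
temperature of the comparison stack at the ceiling couplings `(J∥, J⊥) = (C/2, Δ·C/2)` is itself the row-level ceiling; no hypothesis
beyond the dictionary and the ceiling `ρₑ₀ ≤ C` (`K_χ^{3D}(Δ) = 0` makes the right-hand side `⊤`). Every window of the tree on
`K_χ^{3D}(Δ)` sharpens the right-hand side monotonically; I1's enhancement factor is `E(Δ) = K_χ(2)/K_χ^{3D}(Δ) ≥ 1`
(`PlaneRotator.layeredSusceptibilityCriticalCoupling_le`). [cite: LiuStanley1972, p. 272 (T_c(ε) of the layers (J, J, εJ))] [cite: HazraVermaRanderia2019, §«Three dimensional systems» (phase-ordering reading; eq. (3))] -/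
theorem ofReal_le_layeredSusceptibilityTemperature (h : XYDictionaryAt tp U n Δ ρe0 Tc) {C : ℝ} (hC : ρe0 ≤ C) :
    ENNReal.ofReal Tc ≤ ENNReal.ofReal (C / 2) / layeredSusceptibilityCriticalCoupling Δ := by
  have hCpos : 0 < C := h.ground_pos.trans_le hC
  rcases eq_or_ne (layeredSusceptibilityCriticalCoupling Δ) 0 with h0 | h0
  · rw [h0, ENNReal.div_zero (by simpa using half_pos hCpos)]
    exact le_top
  rcases eq_or_ne (layeredSusceptibilityCriticalCoupling Δ) ⊤ with htop | htop
  · exfalso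
    have hβ : 0 < 2 / Tc := div_pos two_pos h.pos
    have key := h.le_inv_of_mul_lt_layeredSusceptibilityCriticalCoupling hC hβ (by rw [htop]; exact ENNReal.ofReal_lt_top)
    rw [one_div_div] at key
    linarith [h.pos]
  · have hKpos : 0 < (layeredSusceptibilityCriticalCoupling Δ).toReal := ENNReal.toReal_pos h0 htop
    calc ENNReal.ofReal Tc ≤ ENNReal.ofReal (C / 2 / (layeredSusceptibilityCriticalCoupling Δ).toReal) :=
          ENNReal.ofReal_le_ofReal (h.le_div_toReal_layeredSusceptibilityCriticalCoupling hC h0)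
      _ = ENNReal.ofReal (C / 2) / layeredSusceptibilityCriticalCoupling Δ := by
          rw [ENNReal.ofReal_div_of_pos hKpos, ENNReal.ofReal_toReal htop]

/-! ## §3 The two earlier rows through the socket -/

/-- **`Δ ≤ 1/8 ⇒ Tc ≤ (π/4)·C` through the socket** (re-derivation of `XYFisherWindowCeiling.lean` §2
`le_pi_div_four_mul_of_anis_le`): the Fisher window `2/π ≤ K_χ^{3D}(Δ)` for `0 ≤ Δ ≤ 1/8`
(`PlaneRotator.ofReal_two_div_pi_le_layeredSusceptibilityCriticalCoupling`) and `(C/2)/(2/π) = (π/4)·C`.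
[cite: Fisher1967, Phys. Rev. 162 (1967) 480 (T_c bounds from self-avoiding walks)] [cite: HazraVermaRanderia2019, §«Three dimensional systems»] -/
theorem le_pi_div_four_mul_of_anis_le_via_socket (h : XYDictionaryAt tp U n Δ ρe0 Tc) {C : ℝ} (hC : ρe0 ≤ C)
    (hΔ : Δ ≤ 1 / 8) : Tc ≤ Real.pi / 4 * C := by
  have key := h.le_div_of_ofReal_le_layeredSusceptibilityCriticalCoupling hC (by positivity : (0 : ℝ) < 2 / Real.pi)
    (ofReal_two_div_pi_le_layeredSusceptibilityCriticalCoupling h.anis_nonneg hΔ)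
  calc Tc ≤ C / 2 / (2 / Real.pi) := key
    _ = Real.pi / 4 * C := by
        field_simp
        ring

/-- **The RPA interlayer window through the socket, coupling-interval form** (companion of `XYInterlayerCriterionCeiling.lean` §1,
whose temperature form `le_of_interlayer_temperature` is NOT restated here): under the dictionary with a ceiling `ρₑ₀ ≤ C`
(`J∥ := C/2`, `J⊥ := Δ·J∥`), if the single layer's infinite-volume two-point function is summable with `Δ·K·χ₂(K) < 1` at every
reduced coupling `0 ≤ K < c` (`c > 0`), then `ofReal c ≤ K_χ^{3D}(Δ)` (p596136
`PlaneRotator.ofReal_le_layeredSusceptibilityCriticalCoupling_of_forall_interlayer`: «`K_×(Δ) ≤ K_χ^{3D}(Δ)`») and the socket gives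
`Tc ≤ (C/2)/c` — the RPA crossover in coupling currency as a row-level ceiling. [cite: Lieb1980, eq. (23) and notes added in proof (2)] [cite: HazraVermaRanderia2019, §«Three dimensional systems»] -/
theorem le_div_of_forall_interlayer (h : XYDictionaryAt tp U n Δ ρe0 Tc) {C : ℝ} (hC : ρe0 ≤ C) {c : ℝ} (hc : 0 < c)
    (hcrit : ∀ K : ℝ, 0 ≤ K → K < c → (Summable fun w : Site 2 => infTwoPoint K 2 0 w) ∧
      Δ * K * ∑' w : Site 2, infTwoPoint K 2 0 w < 1) : Tc ≤ C / 2 / c :=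
  h.le_div_of_ofReal_le_layeredSusceptibilityCriticalCoupling hC hc
    (ofReal_le_layeredSusceptibilityCriticalCoupling_of_forall_interlayer h.anis_nonneg hcrit)

end XYDictionaryAt

end Summit.Ventures.CertifiedManyBodySolver.Observables
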